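import Mathlib
import HarnessLib
import Summits.CriticalPhenomena.SAWScalingLimit.Theses.SAWDefectDecoherence
import Summits.CriticalPhenomena.SAWScalingLimit.Theorems.SAWDefectDecoherenceDefectDecoherenceSplit

/-!
# Two-way split of the crux `DefectDecoherence` by population: CLEAN ∧ DRESSED
(stmt-CriticalPhenomena-8549; crux-strategist s5; see `Cruxes/DefectDecoherence/STRATEGY-CENSUS.md`
and `Cruxes/DefectDecoherence/WEAK-FORM.md`)

`DefectDecoherence ⇐ CleanDefectDecay ∧ DressedDefectDecay`: by the landed tip regrouping
(`stub_tipRegrouping`: `T = κ (x_c⁻¹ Ā_D + 2 sin(π/24) A_D)`, `Ā_D = A_D + (Ā_D − A_D)`) the pointwise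
crux follows from the mass-relative decay (θ > 3/4) of the CLEAN defect character `A_D` and of the
LOOP-DRESSED defect `Ā_D − A_D`, at the rate `min θ₁ θ₂`.  Both children are spelled over `Literature`
declarations (route-item form); `DressedDefectDecay` is VERBATIM child 4 of the prepared 4-way split
(dictionary `ss_dressedDefectDecay_iff`, landed p143107, = registered stub `stub_dressedDefectDecay` of the
live skeleton); `CleanDefectDecay` is definitionally `∃ C θ, 3/4 < θ ∧ DecayBound cleanDefect C θ`
(`cleanDefectDecay_iff`, `Iff.rfl`) — the conclusion of the landed slaving induction `stub_defectSlaving`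
given the lead's stubs A/4/5/6.  Why this cut (WEAK-FORM.md): the route's node `ConjugateClassNegligible`
needs ONLY the dressed child (in staggered ψ-average); the clean child carries everything the weak form
gets for free by summation by parts, so it is filed `support` (true, predicted θ = 19/16, off the critical
path of `closes`), the dressed child `crux`.
-/

noncomputable section

open scoped BigOperators ComplexConjugate Classical
open Literature.Probability.LatticeModels Literature.Probability.RandomPlanarGeometry.SAW
open Summit.CriticalPhenomena.SAWScalingLimit.Theorems.DefectDecoherence.TipMartingale
open Summit.CriticalPhenomena.SAWScalingLimit.Theorems.DefectDecoherence.SectorSlaving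

namespace Summit.CriticalPhenomena.SAWScalingLimit.Cruxes.DefectDecoherence.Split2

/-- **Dictionary, clean defect**: the route item `CleanDefectDecay` is definitionally
`∃ C θ, 3/4 < θ ∧ DecayBound cleanDefect C θ`. [folklore] -/
theorem cleanDefectDecay_iff :
    (∃ C θ : ℝ, 3 / 4 < θ ∧ ∀ (Λ : Finset Literature.Probability.LatticeModels.HexVertex), Literature.Probability.RandomPlanarGeometry.SAW.hexDomainSimplyConnected Λ → ∀ (u w : Literature.Probability.LatticeModels.HexVertex), Literature.Probability.LatticeModels.hexGraph.Adj u w → u ∉ Λ → w ∈ Λ → ∀ (v : Literature.Probability.LatticeModels.HexVertex) (R : ℝ), 1 ≤ R → (∀ y : Literature.Probability.LatticeModels.HexVertex, dist (Literature.Probability.LatticeModels.hexCenter y) (Literature.Probability.LatticeModels.hexCenter v) ≤ R → y ∈ Λ) → ‖∑ s ∈ Λ.filter (fun q => Literature.Probability.LatticeModels.hexGraph.Adj v q), ∑ γ : Literature.Probability.RandomPlanarGeometry.SAW.HexMidEdgeSAW Λ s(u, w) s(s, v), (if γ.verts.getLast? = some s ∧ v ∉ γ.verts then ((Literature.Probability.RandomPlanarGeometry.SAW.hexCriticalFugacity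 : ℝ) : ℂ) ^ (γ.length + 1) * Complex.exp (-Complex.I * ((13 / 8 : ℝ) : ℂ) * ((Complex.arg (Literature.Probability.LatticeModels.hexCenter w - Literature.Probability.LatticeModels.hexCenter u) + γ.winding : ℝ) : ℂ)) else 0)‖ ≤ C * R ^ (-θ) * ∑ t ∈ Λ.filter (fun t => Literature.Probability.LatticeModels.hexGraph.Adj v t), ‖Literature.Probability.RandomPlanarGeometry.SAW.hexParafermionicObservable Λ s(u, w) Literature.Probability.RandomPlanarGeometry.SAW.hexCriticalFugacity 0 s(v, t)‖) ↔ (∃ C θ : ℝ, 3 / 4 < θ ∧ DecayBound cleanDefect C θ) :=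
  Iff.rfl

/-- `DecayBound cleanDefect ∧ DecayBound dressedDefect ⇒ DecayBound defect` at the rate `min θ₁ θ₂`
(tip regrouping + triangle inequality; `‖κ‖ ≤ 1`, `|2 sin(π/24)| ≤ 2`). [folklore] -/
theorem decayBound_defect_of_clean_of_dressed
    (hClean : ∃ C θ : ℝ, 3 / 4 < θ ∧ DecayBound cleanDefect C θ)
    (hDress : ∃ C θ : ℝ, 3 / 4 < θ ∧ DecayBound dressedDefect C θ) :
    ∃ C θ : ℝ, 3 / 4 < θ ∧ DecayBound defect C θ := by
  obtain ⟨C₁, θ₁, hθ₁, h1⟩ := hClean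
  obtain ⟨C₂, θ₂, hθ₂, h2⟩ := hDress
  have hxc : 0 < xc := hexCriticalFugacity_pos_lt_one.1
  have hxi : 0 ≤ xc⁻¹ := le_of_lt (inv_pos.mpr hxc)
  refine ⟨(xc⁻¹ + 2) * |C₁| + xc⁻¹ * |C₂|, min θ₁ θ₂, lt_min hθ₁ hθ₂, ?_⟩
  intro Λ hΛ u w huw hu hw v R hR hdeep
  have e1' := h1 Λ hΛ u w huw hu hw v R hR hdeep
  have e2' := h2 Λ hΛ u w huw hu hw v R hR hdeep
  have hdeep1 : Deep Λ v 1 := fun y hy => hdeep y (hy.trans hR)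
  obtain ⟨hT, -⟩ := stub_tipRegrouping Λ u w huw hu hw v hdeep1
  set A := arrivalSum Λ s(u, w) (rootAngle u w) (13 / 8) v with hAdef
  set Ab := viaSum Λ s(u, w) (rootAngle u w) (13 / 8) v with hAbdef
  set M := mass Λ u w v with hMdef
  have hA' : cleanDefect Λ u w v = A := rfl
  have hAb' : dressedDefect Λ u w v = Ab - A := rfl
  rw [hA'] at e1'
  rw [hAb'] at e2'
  have hM0 : 0 ≤ M := mass_nonneg Λ u w v
  have hR0 : 0 ≤ R := le_trans zero_le_one hR
  have hmono₁ : R ^ (-θ₁) ≤ R ^ (-min θ₁ θ₂) :=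
    Real.rpow_le_rpow_of_exponent_le hR (neg_le_neg (min_le_left θ₁ θ₂))
  have hmono₂ : R ^ (-θ₂) ≤ R ^ (-min θ₁ θ₂) :=
    Real.rpow_le_rpow_of_exponent_le hR (neg_le_neg (min_le_right θ₁ θ₂))
  have e1 : ‖A‖ ≤ |C₁| * (R ^ (-min θ₁ θ₂) * M) := by
    calc ‖A‖ ≤ C₁ * R ^ (-θ₁) * M := e1'
      _ ≤ |C₁| * R ^ (-θ₁) * M :=
          mul_le_mul_of_nonneg_right
            (mul_le_mul_of_nonneg_right (le_abs_self _) (Real.rpow_nonneg hR0 _)) hM0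
      _ ≤ |C₁| * R ^ (-min θ₁ θ₂) * M :=
          mul_le_mul_of_nonneg_right (mul_le_mul_of_nonneg_left hmono₁ (abs_nonneg _)) hM0
      _ = |C₁| * (R ^ (-min θ₁ θ₂) * M) := by ring
  have e2 : ‖Ab - A‖ ≤ |C₂| * (R ^ (-min θ₁ θ₂) * M) := by
    calc ‖Ab - A‖ ≤ C₂ * R ^ (-θ₂) * M := e2'
      _ ≤ |C₂| * R ^ (-θ₂) * M :=
          mul_le_mul_of_nonneg_right
            (mul_le_mul_of_nonneg_right (le_abs_self _) (Real.rpow_nonneg hR0 _)) hM0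
      _ ≤ |C₂| * R ^ (-min θ₁ θ₂) * M :=
          mul_le_mul_of_nonneg_right (mul_le_mul_of_nonneg_left hmono₂ (abs_nonneg _)) hM0
      _ = |C₂| * (R ^ (-min θ₁ θ₂) * M) := by ring
  have hκ : ‖tipPhase u w‖ ≤ 1 := by
    unfold tipPhase
    rw [norm_mul, Complex.norm_exp_ofReal_mul_I, mul_one, Complex.norm_real, Real.norm_eq_abs,
      abs_neg, abs_of_nonneg (show (0 : ℝ) ≤ Real.sqrt 3 / 6 by positivity)]
    have h3 : Real.sqrt 3 ≤ 6 := by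
      nlinarith [Real.sq_sqrt (show (0 : ℝ) ≤ 3 by norm_num), Real.sqrt_nonneg 3]
    linarith
  have hsin : |2 * Real.sin (Real.pi / 24)| ≤ 2 := by
    rw [abs_le]
    constructor
    · nlinarith [Real.neg_one_le_sin (Real.pi / 24)]
    · nlinarith [Real.sin_le_one (Real.pi / 24)]
  have hX :
      ‖((xc⁻¹ : ℝ) : ℂ) * Ab + ((2 * Real.sin (Real.pi / 24) : ℝ) : ℂ) * A‖ ≤
        xc⁻¹ * ‖Ab‖ + 2 * ‖A‖ := by
    refine (norm_add_le _ _).trans ?_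
    rw [norm_mul, norm_mul, Complex.norm_real, Complex.norm_real, Real.norm_eq_abs,
      Real.norm_eq_abs, abs_of_nonneg hxi]
    have : |2 * Real.sin (Real.pi / 24)| * ‖A‖ ≤ 2 * ‖A‖ :=
      mul_le_mul_of_nonneg_right hsin (norm_nonneg _)
    linarith
  have hT' : ‖defect Λ u w v‖ ≤ xc⁻¹ * ‖Ab‖ + 2 * ‖A‖ := by
    rw [hT, norm_mul]
    have hk := mul_le_mul_of_nonneg_right hκ
      (norm_nonneg (((xc⁻¹ : ℝ) : ℂ) * Ab + ((2 * Real.sin (Real.pi / 24) : ℝ) : ℂ) * A))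
    linarith
  have hAb'' : ‖Ab‖ ≤ ‖A‖ + ‖Ab - A‖ := by
    calc ‖Ab‖ = ‖A + (Ab - A)‖ := by congr 1; ring
      _ ≤ ‖A‖ + ‖Ab - A‖ := norm_add_le _ _
  have e3 : xc⁻¹ * ‖Ab‖ ≤ xc⁻¹ * (‖A‖ + ‖Ab - A‖) := mul_le_mul_of_nonneg_left hAb'' hxi
  have e4 := mul_le_mul_of_nonneg_left e1 hxi
  have e5 := mul_le_mul_of_nonneg_left e2 hxi
  calc ‖defect Λ u w v‖ ≤ xc⁻¹ * ‖Ab‖ + 2 * ‖A‖ := hT'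
    _ ≤ xc⁻¹ * (‖A‖ + ‖Ab - A‖) + 2 * ‖A‖ := by linarith
    _ ≤ xc⁻¹ * (|C₁| * (R ^ (-min θ₁ θ₂) * M) + |C₂| * (R ^ (-min θ₁ θ₂) * M)) +
          2 * (|C₁| * (R ^ (-min θ₁ θ₂) * M)) := by
        linarith
    _ = ((xc⁻¹ + 2) * |C₁| + xc⁻¹ * |C₂|) * R ^ (-min θ₁ θ₂) * M := by ring

/-- **The split glue** `CleanDefectDecay → DressedDefectDecay → DefectDecoherence`, both hypotheses in
route-item form (spelled over `Literature` declarations exactly as filed), conclusion the crux BY NAME.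
[folklore] -/
theorem defectDecoherence_of_clean_of_dressed :
    (∃ C θ : ℝ, 3 / 4 < θ ∧ ∀ (Λ : Finset Literature.Probability.LatticeModels.HexVertex), Literature.Probability.RandomPlanarGeometry.SAW.hexDomainSimplyConnected Λ → ∀ (u w : Literature.Probability.LatticeModels.HexVertex), Literature.Probability.LatticeModels.hexGraph.Adj u w → u ∉ Λ → w ∈ Λ → ∀ (v : Literature.Probability.LatticeModels.HexVertex) (R : ℝ), 1 ≤ R → (∀ y : Literature.Probability.LatticeModels.HexVertex, dist (Literature.Probability.LatticeModels.hexCenter y) (Literature.Probability.LatticeModels.hexCenter v) ≤ R → y ∈ Λ) → ‖∑ s ∈ Λ.filter (fun q => Literature.Probability.LatticeModels.hexGraph.Adj v q), ∑ γ : Literature.Probability.RandomPlanarGeometry.SAW.HexMidEdgeSAW Λ s(u, w) s(s, v), (if γ.verts.getLast? = some s ∧ v ∉ γ.verts then ((Literature.Probability.RandomPlanarGeometry.SAW.hexCriticalFugacity : ℝ) : ℂ) ^ (γ.length + 1) * Complex.exp (-Complex.I * ((13 / 8 : ℝ) : ℂ) * ((Complex.arg (Literature.Probability.LatticeModels.hexCenter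 w - Literature.Probability.LatticeModels.hexCenter u) + γ.winding : ℝ) : ℂ)) else 0)‖ ≤ C * R ^ (-θ) * ∑ t ∈ Λ.filter (fun t => Literature.Probability.LatticeModels.hexGraph.Adj v t), ‖Literature.Probability.RandomPlanarGeometry.SAW.hexParafermionicObservable Λ s(u, w) Literature.Probability.RandomPlanarGeometry.SAW.hexCriticalFugacity 0 s(v, t)‖) →
    (∃ C θ : ℝ, 3 / 4 < θ ∧ ∀ (Λ : Finset Literature.Probability.LatticeModels.HexVertex), Literature.Probability.RandomPlanarGeometry.SAW.hexDomainSimplyConnected Λ → ∀ (u w : Literature.Probability.LatticeModels.HexVertex), Literature.Probability.LatticeModels.hexGraph.Adj u w → u ∉ Λ → w ∈ Λ → ∀ (v : Literature.Probability.LatticeModels.HexVertex) (R : ℝ), 1 ≤ R → (∀ y : Literature.Probability.LatticeModels.HexVertex, dist (Literature.Probability.LatticeModels.hexCenter y) (Literature.Probability.LatticeModels.hexCenter v) ≤ R → y ∈ Λ) → ‖(∑ s ∈ Λ.filter (fun q => Literature.Probability.LatticeModels.hexGraph.Adj v q), ∑ γ : Literature.Probability.RandomPlanarGeometry.SAW.HexMidEdgeSAW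 Λ s(u, w) s(s, v), (if γ.verts.getLast? = some s then ((Literature.Probability.RandomPlanarGeometry.SAW.hexCriticalFugacity : ℝ) : ℂ) ^ (γ.length + 1) * Complex.exp (-Complex.I * ((13 / 8 : ℝ) : ℂ) * ((Complex.arg (Literature.Probability.LatticeModels.hexCenter w - Literature.Probability.LatticeModels.hexCenter u) + γ.winding : ℝ) : ℂ)) else 0)) - (∑ s ∈ Λ.filter (fun q => Literature.Probability.LatticeModels.hexGraph.Adj v q), ∑ γ : Literature.Probability.RandomPlanarGeometry.SAW.HexMidEdgeSAW Λ s(u, w) s(s, v), (if γ.verts.getLast? = some s ∧ v ∉ γ.verts then ((Literature.Probability.RandomPlanarGeometry.SAW.hexCriticalFugacity : ℝ) : ℂ) ^ (γ.length + 1) * Complex.exp (-Complex.I * ((13 / 8 : ℝ) : ℂ) * ((Complex.arg (Literature.Probability.LatticeModels.hexCenter w - Literature.Probability.LatticeModels.hexCenter u) + γ.winding : ℝ) : ℂ)) else 0))‖ ≤ C * R ^ (-θ) * ∑ t ∈ Λ.filter (fun t => Literature.Probability.LatticeModels.hexGraph.Adj v t), ‖Literature.Probability.RandomPlanarGeometry.SAW.hexParafermionicObservable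 Λ s(u, w) Literature.Probability.RandomPlanarGeometry.SAW.hexCriticalFugacity 0 s(v, t)‖) →
      Summit.CriticalPhenomena.SAWScalingLimit.Theses.SAWDefectDecoherence.DefectDecoherence := by
  intro hClean hDress
  rw [cleanDefectDecay_iff] at hClean
  rw [ss_dressedDefectDecay_iff] at hDress
  obtain ⟨C, θ, hθ, hD⟩ := decayBound_defect_of_clean_of_dressed hClean hDress
  exact ⟨C, θ, hθ, fun Λ hΛ u w huw hu hw v R hR hdeep => hD Λ hΛ u w huw hu hw v R hR hdeep⟩

end Summit.CriticalPhenomena.SAWScalingLimit.Cruxes.DefectDecoherence.Split2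

end
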